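import HarnessLib
import Summits.Ventures.WeilGRH.RealCharacterSmallModuli
import Summits.Ventures.WeilGRH.KCellsMod11OneA
import Summits.Ventures.WeilGRH.KCellsMod11OneB

/-!
# GRH arm (rh-explicit, venture WeilGRH): Weil positivity on `[−1, 1]` for EVERY non-principal EVEN Dirichlet character mod 11

Cell `rh-explicit`, WEIL TRACK — GRH ARM (seat weil-grh-1 gen12; pure assembly over weil-grh-2 gen15's checker-K χ-cells `KCellsMod11OneA/B`).
`(ℤ/11)ˣ = ⟨2⟩` is cyclic of order 10, so `χ(2) = ζ^i` with `ζ = exp(2πi/10)`, `i < 10`, and `χ(−1) = χ(2)^5 = (−1)^i`.  The even non-principal characters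
are the two quintic conjugate pairs `i = 2, 8` (`KCellsMod11OneA`: `…_mod11_chi4_one` / `_conj`) and `i = 4, 6` (`KCellsMod11OneB`: `…_mod11_chi5_one` / `_conj`).
The five odd characters are NOT claimed at `t = 1`.  Pure assembly; RH/GRH-free; standard axioms.
-/

noncomputable section

namespace Summit.Ventures.WeilGRH.OneCompleteMod11Even
open Literature.NumberTheory.LFunctions
open scoped Real

/-- `exp(2πi/10)^5 = −1`. [folklore] -/
theorem zeta_pow_half_mod11 : (Complex.exp (2 * ↑Real.pi * Complex.I / 10)) ^ 5 = -1 := by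
  rw [← Complex.exp_nat_mul, show ((5 : ℕ) : ℂ) * (2 * ↑Real.pi * Complex.I / 10) = ↑Real.pi * Complex.I by push_cast; ring]
  exact Complex.exp_pi_mul_I

/-- ★ **Every non-principal EVEN Dirichlet character mod 11 satisfies Weil positivity on `[−1, 1]`.**
[cite: Weil1952FormulesExplicites, (11) pp. 261–262 and the «lemme» p. 262] -/
theorem weilPositivityOnChar_mod11_one_of_even (χ : DirichletCharacter ℂ 11) (hχ : χ ≠ 1) (he : χ.Even) :
    WeilPositivityOnChar χ 1 := by
  have hz : χ (2 : ZMod 11) ^ 10 = 1 := by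
    rw [← map_pow, show (2 : ZMod 11) ^ 10 = 1 from by decide, map_one]
  have hprim : IsPrimitiveRoot (Complex.exp (2 * ↑Real.pi * Complex.I / 10)) 10 := by
    exact_mod_cast Complex.isPrimitiveRoot_exp 10 (by norm_num)
  obtain ⟨i, hi, hiz⟩ := hprim.eq_pow_of_pow_eq_one hz
  have hm1 : χ (-1) = (Complex.exp (2 * ↑Real.pi * Complex.I / 10)) ^ (i * 5) := by
    rw [pow_mul, hiz, ← map_pow, show (2 : ZMod 11) ^ 5 = -1 from by decide]
  have he1 : χ (-1) = 1 := he
  interval_cases i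
  · exact absurd (RealCharacterSmallModuli.eq_one_of_apply_gen RealCharacterSmallModuli.units_mod_eleven_gen (by rw [← hiz, pow_zero])) hχ
  · exfalso; rw [hm1, show 1 * 5 = 5 from rfl, zeta_pow_half_mod11] at he1; norm_num at he1
  · exact KCellsMod11OneA.weilPositivityOnChar_mod11_chi4_one χ hiz.symm
  · exfalso; rw [hm1, show 3 * 5 = 5 * 3 from rfl, pow_mul, zeta_pow_half_mod11] at he1; norm_num at he1
  · exact KCellsMod11OneB.weilPositivityOnChar_mod11_chi5_one χ hiz.symm
  · exfalso; rw [hm1, show 5 * 5 = 5 * 5 from rfl, pow_mul, zeta_pow_half_mod11] at he1; norm_num at he1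
  · exact KCellsMod11OneB.weilPositivityOnChar_mod11_chi5_one_conj χ hiz.symm
  · exfalso; rw [hm1, show 7 * 5 = 5 * 7 from rfl, pow_mul, zeta_pow_half_mod11] at he1; norm_num at he1
  · exact KCellsMod11OneA.weilPositivityOnChar_mod11_chi4_one_conj χ hiz.symm
  · exfalso; rw [hm1, show 9 * 5 = 5 * 9 from rfl, pow_mul, zeta_pow_half_mod11] at he1; norm_num at he1

/-- Even non-principal characters mod 11 are Weil-positive on every window `[−t, t]`, `t ≤ 1`. [folklore] -/
theorem weilPositivityOnChar_of_le_one_mod11_of_even (χ : DirichletCharacter ℂ 11) (hχ : χ ≠ 1) (he : χ.Even) {t : ℝ} (ht : t ≤ 1) :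
    WeilPositivityOnChar χ t := fun g hg hsupp ↦
  weilPositivityOnChar_mod11_one_of_even χ hχ he g hg (hsupp.trans (Set.Icc_subset_Icc (by linarith) ht))

end Summit.Ventures.WeilGRH.OneCompleteMod11Even

end
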